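/-
Copyright (c) 2026 the pub-hodgecm-mathlib formalisation cell (harness21).  Prover seat hodgecm-mathlib-LH5-p04 (g11), 2026-09-03.  E1 row 56-B3(55-PF) «PLACE-FREE SIBLINGS OF
THE 55-A FILES», file (O): the any-involution ∕ tame twin of ★ A-III `UnitaryLatticeTreeOrbitsViaApartment` (keeper F0P3a-p03 (g30) 04:09:00Z ∕ «=» 04:13:25Z; census
`CENSUS-SIGSHEET-B355PF.v1` 4e3d4b85fe811f96).
-/
import Literature.NumberTheory.Automorphic.UnitaryLatticeTreeOrbitsViaApartment                   -- ★ A-III p853494 (LH5-p05 (g12)): the datum-free `latticeGraphIso_weylLongU_apartmentEnum`; brings ★ A-II, ★ 39γ, ★ `type_unique`, ★ `isVertexLattice_mapGL_iff`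
import Literature.NumberTheory.Automorphic.UnitaryLatticeTreeHorosphereTransversalOfInvolution   -- (T-I) (this seat): (H5) `…_eq_of_involution`, (H7s) `…sym2Map…_of_adj_of_involution`; brings (S) `…_of_adj_of_neg`, ★ R1 (T) `…_eq_add_of_involution`, ★ B1 `…_succ_of_involution`, ★ R5a `…_zpow_of_v`
import Literature.NumberTheory.Automorphic.UnitaryLatticeTreeFramesOfInvolution                   -- ★ (B-p14 ∕ F0P3a lineage): `isTree_latticeGraph_three_of_neg` (the tame-ramified lattice graph is a tree)
import HarnessLib

/-!
# The `U(σ, J₀)`-orbits on the `U(3)` tree via the apartment, FOR ANY ISOMETRIC INVOLUTION (hypothesis-style) and AT A TAMELY RAMIFIED PLACE (unconditionally):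
# two vertex orbits `U · A 0`, `U · A 1`, one edge orbit `U · {A 0, A 1}` (Bruhat–Tits 1972 §10, (4.4.4); Tits 1979 §2.4; Serre, *Trees* II.1.1)

Topic `NumberTheory/Automorphic`; namespace `Literature.NumberTheory.Automorphic.UnitaryLatticeTree`.  THEOREMS ONLY (no definition, no instance, no notation, no named
fact, no `sorry`).  Cell `pub/hodgecm-mathlib` (D-0151), crux H413 = `stmt-HodgeConjecture-24833`, lane `--supports`; E1 BRICK LEDGER row 56-B3(55-PF) (keeper F0P3a-p03
(g30); LEAD T15-42 (iii)): the PLACE-FREE sibling of ★ A-III `UnitaryLatticeTreeOrbitsViaApartment`.  ★ A-III binds the UNRAMIFIED datum `hd` and reads of it `σ² = 1`,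
`σϖ = ϖ` (only to certify the types of `A 0`, `A 1` — ★ R5a's `_of_v` lemmas do this for any isometric involution), `|σ·| = |·|`, `|ϖ| = exp(−1)`; the genuinely unramified
inputs are its CALLEES (H5)∕(H7s) (tree-ness, star dichotomy) and the torus translation (T).  As in (S)∕(T-I): LAYER I `_of_involution` for ANY isometric involution
`(hσ hvσ hϖ)`, apartment HYPOTHESIS-STYLE `(A hA0 hA1)`, with the two unramified-rooted inputs as the hypotheses **`hT : IsTree`** and **`hH4`** (★ (H4)'s conclusion
∀-closed) and (T) from R1 BY IMPORT; the type ∕ exclusivity heads turn out PLACE-FREE (`_of_v (hσ hvσ hϖ)`, no hypothesis).  LAYER II `_of_neg`: at a TAMELY RAMIFIED place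
(`σϖ = −ϖ`, `hres`, `|2| = 1`, `hnorm`; `[ValuativeRel K]`) the hypotheses are discharged by ★ `isTree_latticeGraph_three_of_neg` and (S)
`eq_apartmentEnum_sub_one_or_exists_mem_unipotentU_of_adj_of_neg` — one-liners; these are the heads the tame twin of the datum file 55-B calls (token pass `hd ↦ hσ hvσ hϖ
hσϖ hres h2 hnorm`).  Every conclusion is ★ A-III's VERBATIM (edge certificates print ★ B1's `latticeGraph_adj_apartmentEnum_succ_of_involution`, proof-irrelevant); every
Layer-I proof is ★ A-III's with the callees swapped; ★ `latticeGraphIso_weylLongU_apartmentEnum` (datum-free) is used BY NAME.  HONEST LABEL: count-neutral generic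
lattice-tree layer (TAME road GO-LOW, WILD = PRINT; E1 = PRINT); HC_CM is proved only modulo the 7 printed citations (2 remaining named inputs hLiu418 =
`stmt-HodgeConjecture-24832`, h413 = `stmt-HodgeConjecture-24833`) until rung 0 closes; nothing printed is asserted here.

WHAT IS FORMALISED.  §1 `isSelfDualLattice_apartmentEnum_zero_of_v`, `isVertexLattice_two_apartmentEnum_one_of_v` (PF).  §2 `exists_latticeGraphIso_apartmentEnum_zero_eq_or_one_eq_of_involution
(hσ hvσ hϖ) (A hA0 hA1) (hT) (hH4) (x)`, `not_exists_latticeGraphIso_apartmentEnum_one_eq_zero_of_v`, `not_exists_…_zero_eq_and_one_eq_of_v` (PF).  §3 `exists_latticeGraphIso_sym2Map_apartmentEnum_zero_one_eq_of_adj_of_involution`,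
`…_zero_one_eq_of_adj_of_involution`, `…mapEdgeSet…_zero_one_eq_of_involution`.  §4 `exists_vertexOrbitData_of_involution`, `exists_edgeOrbitData_of_involution`.  §5 LAYER II: the six `_of_neg` forms.

## References
* [BruhatTits1972] F. Bruhat, J. Tits, *Groupes réductifs sur un corps local I*, Publ. Math. IHÉS 41 (1972), §10, (4.4.4).
* [Tits1979] J. Tits, *Reductive groups over local fields*, Proc. Sympos. Pure Math. 33.1 (1979), §2.4 (the ramified quasi-split `SU₃`: both vertex types special), §3.3.3.
* [Serre1980Trees] J.-P. Serre, *Trees* (1980), Ch. II §1.1.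
-/

set_option autoImplicit false

open scoped Valued WithZero Matrix MatrixGroups

namespace Literature.NumberTheory.Automorphic.UnitaryLatticeTree

open _root_.SimpleGraph Literature.NumberTheory.Automorphic Literature.NumberTheory.Automorphic.HermitianLattice
open Literature.NumberTheory.Automorphic.UnitaryGroup
open Literature.NumberTheory.Automorphic.CartanUnique (uniformizer_ne_zero)

variable {K : Type*} [Field K] [Valued K ℤᵐ⁰] {σ : K →+* K} {ϖ : K}

/-! ## §1 The types of `A 0` and `A 1`, place-free (★ `latticeGraphIso_weylLongU_apartmentEnum` is datum-free and used by name) -/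

/-- **`A 0 = L₀` IS SELF-DUAL FOR ANY ISOMETRIC INVOLUTION** (type `0`) — PLACE-FREE twin of ★ `isSelfDualLattice_apartmentEnum_zero` over ★ R5a `isSelfDualLattice_latt_diagonal_zpow_of_v`
(the unitary witness is `diag(ϖ^a, 1, (σϖ)^{−a})`).  Conclusion VERBATIM. [cite: BruhatTits1972, §10] [cite: Serre1980Trees, II.1.1] -/
theorem isSelfDualLattice_apartmentEnum_zero_of_v (hσ : ∀ x, σ (σ x) = x) (hvσ : ∀ a, Valued.v (σ a) = Valued.v a) (hϖ : Valued.v ϖ = WithZero.exp (-1 : ℤ))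
    (A : ℤ → {M : Submodule 𝒪[K] (Fin 3 → K) // IsVertex σ ϖ ((StdForm.antidiagonal 3).over K) M})
    (hA0 : ∀ a : ℤ, (A (2 * a)).1 = latt (Matrix.diagonal ![ϖ ^ a, (1 : K), ϖ ^ (-a)])) : IsSelfDualLattice σ ϖ ((StdForm.antidiagonal 3).over K) (A 0).1 := by
  have h := hA0 0
  rw [mul_zero] at h
  rw [h]
  exact isSelfDualLattice_latt_diagonal_zpow_of_v hσ hvσ hϖ 0

/-- **`A 1 = L′₁` HAS TYPE `2` FOR ANY ISOMETRIC INVOLUTION** — PLACE-FREE twin of ★ `isVertexLattice_two_apartmentEnum_one` over ★ R5a `isVertexLattice_two_latt_diagonal_zpow_of_v`.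
Conclusion VERBATIM. [cite: BruhatTits1972, §10] [cite: Serre1980Trees, II.1.1] -/
theorem isVertexLattice_two_apartmentEnum_one_of_v (hσ : ∀ x, σ (σ x) = x) (hvσ : ∀ a, Valued.v (σ a) = Valued.v a) (hϖ : Valued.v ϖ = WithZero.exp (-1 : ℤ))
    (A : ℤ → {M : Submodule 𝒪[K] (Fin 3 → K) // IsVertex σ ϖ ((StdForm.antidiagonal 3).over K) M})
    (hA1 : ∀ a : ℤ, (A (2 * a + 1)).1 = latt (Matrix.diagonal ![ϖ ^ (a + 1), (1 : K), ϖ ^ (-a)])) : IsVertexLattice σ ϖ ((StdForm.antidiagonal 3).over K) 2 (A 1).1 := by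
  have h := hA1 0
  rw [show (2 * 0 + 1 : ℤ) = 1 by ring] at h
  rw [h]
  convert isVertexLattice_two_latt_diagonal_zpow_of_v hσ hvσ hϖ 1 using 4 <;> simp

/-! ## §2 Vertices: `X = U · A 0 ⊔ U · A 1`, hypothesis-style; exclusivity place-free -/

/-- **EVERY VERTEX IS `u · A 0` OR `u · A 1`, hypothesis-style** ((H5) over `hT`, `hH4`; `A (2c) = t_c · A 0`, `A (2c+1) = t_c · A 1` by R1's any-involution (T)).  Twin of ★
`exists_latticeGraphIso_apartmentEnum_zero_eq_or_one_eq`; conclusion VERBATIM. [cite: BruhatTits1972, §10] [cite: Serre1980Trees, II.1.1] -/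
theorem exists_latticeGraphIso_apartmentEnum_zero_eq_or_one_eq_of_involution (hσ : ∀ x, σ (σ x) = x) (hvσ : ∀ a, Valued.v (σ a) = Valued.v a) (hϖ : Valued.v ϖ = WithZero.exp (-1 : ℤ))
    (A : ℤ → {M : Submodule 𝒪[K] (Fin 3 → K) // IsVertex σ ϖ ((StdForm.antidiagonal 3).over K) M})
    (hA0 : ∀ a : ℤ, (A (2 * a)).1 = latt (Matrix.diagonal ![ϖ ^ a, (1 : K), ϖ ^ (-a)]))
    (hA1 : ∀ a : ℤ, (A (2 * a + 1)).1 = latt (Matrix.diagonal ![ϖ ^ (a + 1), (1 : K), ϖ ^ (-a)]))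
    (hT : (latticeGraph σ ϖ ((StdForm.antidiagonal 3).over K)).IsTree)
    (hH4 : ∀ (j : ℤ) (y : {M : Submodule 𝒪[K] (Fin 3 → K) // IsVertex σ ϖ ((StdForm.antidiagonal 3).over K) M}),
      (latticeGraph σ ϖ ((StdForm.antidiagonal 3).over K)).Adj (A j) y → y = A (j - 1) ∨
      ∃ n : unitaryGroupOfForm σ ((StdForm.antidiagonal 3).over K), n ∈ unipotentU σ ((StdForm.antidiagonal 3).over K) ∧
        latticeGraphIso σ ϖ ((StdForm.antidiagonal 3).over K) n (A j) = A j ∧ latticeGraphIso σ ϖ ((StdForm.antidiagonal 3).over K) n (A (j + 1)) = y)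
    (x : {M : Submodule 𝒪[K] (Fin 3 → K) // IsVertex σ ϖ ((StdForm.antidiagonal 3).over K) M}) :
    ∃ u : unitaryGroupOfForm σ ((StdForm.antidiagonal 3).over K),
      latticeGraphIso σ ϖ ((StdForm.antidiagonal 3).over K) u (A 0) = x ∨ latticeGraphIso σ ϖ ((StdForm.antidiagonal 3).over K) u (A 1) = x := by
  obtain ⟨n, -, j, hj⟩ := exists_mem_unipotentU_latticeGraphIso_apartmentEnum_eq_of_involution A hT hH4 x
  obtain ⟨c, rfl | rfl⟩ := Int.even_or_odd' j
  · obtain ⟨t, -, -, htA⟩ := exists_mem_torusU_latticeGraphIso_apartmentEnum_eq_add_of_involution hσ hvσ hϖ A hA0 hA1 c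
    refine ⟨n * t, Or.inl ?_⟩
    rw [latticeGraphIso_mul_apply, htA, zero_add]
    exact hj
  · obtain ⟨t, -, -, htA⟩ := exists_mem_torusU_latticeGraphIso_apartmentEnum_eq_add_of_involution hσ hvσ hϖ A hA0 hA1 c
    refine ⟨n * t, Or.inr ?_⟩
    rw [latticeGraphIso_mul_apply, htA, add_comm]
    exact hj

/-- **NO `u ∈ U` MAPS `A 1` TO `A 0`, FOR ANY ISOMETRIC INVOLUTION** — PLACE-FREE (types `2 ≠ 0` are `U`-invariant and unique: ★ `isVertexLattice_mapGL_iff`, ★ `type_unique hvσ hϖ`).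
Twin of ★ `not_exists_latticeGraphIso_apartmentEnum_one_eq_zero`; conclusion VERBATIM. [cite: BruhatTits1972, §10] [cite: Serre1980Trees, II.1.1] -/
theorem not_exists_latticeGraphIso_apartmentEnum_one_eq_zero_of_v (hσ : ∀ x, σ (σ x) = x) (hvσ : ∀ a, Valued.v (σ a) = Valued.v a) (hϖ : Valued.v ϖ = WithZero.exp (-1 : ℤ))
    (A : ℤ → {M : Submodule 𝒪[K] (Fin 3 → K) // IsVertex σ ϖ ((StdForm.antidiagonal 3).over K) M})
    (hA0 : ∀ a : ℤ, (A (2 * a)).1 = latt (Matrix.diagonal ![ϖ ^ a, (1 : K), ϖ ^ (-a)]))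
    (hA1 : ∀ a : ℤ, (A (2 * a + 1)).1 = latt (Matrix.diagonal ![ϖ ^ (a + 1), (1 : K), ϖ ^ (-a)])) :
    ¬ ∃ u : unitaryGroupOfForm σ ((StdForm.antidiagonal 3).over K), latticeGraphIso σ ϖ ((StdForm.antidiagonal 3).over K) u (A 1) = A 0 := by
  rintro ⟨u, hu⟩
  have h2 : IsVertexLattice σ ϖ ((StdForm.antidiagonal 3).over K) 2 (A 0).1 := by
    rw [← hu, latticeGraphIso_apply_val, isVertexLattice_mapGL_iff]
    exact isVertexLattice_two_apartmentEnum_one_of_v hσ hvσ hϖ A hA1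
  have := type_unique hvσ hϖ (isSelfDualLattice_apartmentEnum_zero_of_v hσ hvσ hϖ A hA0) h2
  omega

/-- **EXCLUSIVITY, FOR ANY ISOMETRIC INVOLUTION** — PLACE-FREE: a vertex is not both `u · A 0` and `u′ · A 1`.  Twin of ★ `not_exists_latticeGraphIso_apartmentEnum_zero_eq_and_one_eq`;
conclusion VERBATIM. [cite: BruhatTits1972, §10] [cite: Serre1980Trees, II.1.1] -/
theorem not_exists_latticeGraphIso_apartmentEnum_zero_eq_and_one_eq_of_v (hσ : ∀ x, σ (σ x) = x) (hvσ : ∀ a, Valued.v (σ a) = Valued.v a) (hϖ : Valued.v ϖ = WithZero.exp (-1 : ℤ))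
    (A : ℤ → {M : Submodule 𝒪[K] (Fin 3 → K) // IsVertex σ ϖ ((StdForm.antidiagonal 3).over K) M})
    (hA0 : ∀ a : ℤ, (A (2 * a)).1 = latt (Matrix.diagonal ![ϖ ^ a, (1 : K), ϖ ^ (-a)]))
    (hA1 : ∀ a : ℤ, (A (2 * a + 1)).1 = latt (Matrix.diagonal ![ϖ ^ (a + 1), (1 : K), ϖ ^ (-a)]))
    (x : {M : Submodule 𝒪[K] (Fin 3 → K) // IsVertex σ ϖ ((StdForm.antidiagonal 3).over K) M}) :
    ¬ ((∃ u : unitaryGroupOfForm σ ((StdForm.antidiagonal 3).over K), latticeGraphIso σ ϖ ((StdForm.antidiagonal 3).over K) u (A 0) = x) ∧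
       ∃ u' : unitaryGroupOfForm σ ((StdForm.antidiagonal 3).over K), latticeGraphIso σ ϖ ((StdForm.antidiagonal 3).over K) u' (A 1) = x) := by
  rintro ⟨⟨u, hu⟩, ⟨u', hu'⟩⟩
  refine not_exists_latticeGraphIso_apartmentEnum_one_eq_zero_of_v hσ hvσ hϖ A hA0 hA1 ⟨u⁻¹ * u', ?_⟩
  rw [latticeGraphIso_mul_apply, hu', ← hu, latticeGraphIso_inv_mul_apply]

/-! ## §3 Edges: `U` is transitive on the edges, hypothesis-style -/

/-- **`U(σ, J₀)` IS TRANSITIVE ON THE EDGES OF ITS TREE, hypothesis-style**: every edge `{x, y}` is `u · {A 0, A 1}` ((H7s) over `hT`, `hH4`; `u = n t_c` or `n t_{c+1} w₀` with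
R1's any-involution torus and ★ `latticeGraphIso_weylLongU_apartmentEnum`).  Twin of ★ `exists_latticeGraphIso_sym2Map_apartmentEnum_zero_one_eq_of_adj`; conclusion VERBATIM.
[cite: BruhatTits1972, §10, (4.4.4)] [cite: Serre1980Trees, II.1.1] -/
theorem exists_latticeGraphIso_sym2Map_apartmentEnum_zero_one_eq_of_adj_of_involution (hσ : ∀ x, σ (σ x) = x) (hvσ : ∀ a, Valued.v (σ a) = Valued.v a) (hϖ : Valued.v ϖ = WithZero.exp (-1 : ℤ))
    (A : ℤ → {M : Submodule 𝒪[K] (Fin 3 → K) // IsVertex σ ϖ ((StdForm.antidiagonal 3).over K) M})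
    (hA0 : ∀ a : ℤ, (A (2 * a)).1 = latt (Matrix.diagonal ![ϖ ^ a, (1 : K), ϖ ^ (-a)]))
    (hA1 : ∀ a : ℤ, (A (2 * a + 1)).1 = latt (Matrix.diagonal ![ϖ ^ (a + 1), (1 : K), ϖ ^ (-a)]))
    (hT : (latticeGraph σ ϖ ((StdForm.antidiagonal 3).over K)).IsTree)
    (hH4 : ∀ (j : ℤ) (y : {M : Submodule 𝒪[K] (Fin 3 → K) // IsVertex σ ϖ ((StdForm.antidiagonal 3).over K) M}),
      (latticeGraph σ ϖ ((StdForm.antidiagonal 3).over K)).Adj (A j) y → y = A (j - 1) ∨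
      ∃ n : unitaryGroupOfForm σ ((StdForm.antidiagonal 3).over K), n ∈ unipotentU σ ((StdForm.antidiagonal 3).over K) ∧
        latticeGraphIso σ ϖ ((StdForm.antidiagonal 3).over K) n (A j) = A j ∧ latticeGraphIso σ ϖ ((StdForm.antidiagonal 3).over K) n (A (j + 1)) = y)
    {x y : {M : Submodule 𝒪[K] (Fin 3 → K) // IsVertex σ ϖ ((StdForm.antidiagonal 3).over K) M}}
    (hxy : (latticeGraph σ ϖ ((StdForm.antidiagonal 3).over K)).Adj x y) :
    ∃ u : unitaryGroupOfForm σ ((StdForm.antidiagonal 3).over K), Sym2.map (latticeGraphIso σ ϖ ((StdForm.antidiagonal 3).over K) u) s(A 0, A 1) = s(x, y) := by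
  obtain ⟨n, -, j, hj⟩ := exists_mem_unipotentU_sym2Map_apartmentEnum_eq_of_adj_of_involution A hT hH4 hxy
  rw [Sym2.map_mk] at hj
  obtain ⟨c, rfl | rfl⟩ := Int.even_or_odd' j
  · obtain ⟨t, -, -, htA⟩ := exists_mem_torusU_latticeGraphIso_apartmentEnum_eq_add_of_involution hσ hvσ hϖ A hA0 hA1 c
    refine ⟨n * t, ?_⟩
    rw [Sym2.map_mk, latticeGraphIso_mul_apply, latticeGraphIso_mul_apply, htA, htA, zero_add, add_comm 1 (2 * c)]
    exact hj
  · obtain ⟨t, -, -, htA⟩ := exists_mem_torusU_latticeGraphIso_apartmentEnum_eq_add_of_involution hσ hvσ hϖ A hA0 hA1 (c + 1)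
    refine ⟨n * t * weylLongU σ (rfl : (StdForm.antidiagonal 3).over K = (StdForm.antidiagonal 3).over K), ?_⟩
    rw [Sym2.map_mk, latticeGraphIso_mul_apply, latticeGraphIso_mul_apply, latticeGraphIso_mul_apply, latticeGraphIso_mul_apply,
      latticeGraphIso_weylLongU_apartmentEnum A hA0 hA1, latticeGraphIso_weylLongU_apartmentEnum A hA0 hA1, neg_zero, htA, htA,
      show (0 : ℤ) + 2 * (c + 1) = 2 * c + 1 + 1 by ring, show (-1 : ℤ) + 2 * (c + 1) = 2 * c + 1 by ring, Sym2.eq_swap]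
    exact hj

/-- **Oriented-or form, hypothesis-style**: `(x, y) = (u·A 0, u·A 1)` or `(y, x) = (u·A 0, u·A 1)`.  Twin of ★ `exists_latticeGraphIso_apartmentEnum_zero_one_eq_of_adj`; conclusion VERBATIM.
[cite: BruhatTits1972, §10, (4.4.4)] [cite: Serre1980Trees, II.1.1] -/
theorem exists_latticeGraphIso_apartmentEnum_zero_one_eq_of_adj_of_involution (hσ : ∀ x, σ (σ x) = x) (hvσ : ∀ a, Valued.v (σ a) = Valued.v a) (hϖ : Valued.v ϖ = WithZero.exp (-1 : ℤ))
    (A : ℤ → {M : Submodule 𝒪[K] (Fin 3 → K) // IsVertex σ ϖ ((StdForm.antidiagonal 3).over K) M})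
    (hA0 : ∀ a : ℤ, (A (2 * a)).1 = latt (Matrix.diagonal ![ϖ ^ a, (1 : K), ϖ ^ (-a)]))
    (hA1 : ∀ a : ℤ, (A (2 * a + 1)).1 = latt (Matrix.diagonal ![ϖ ^ (a + 1), (1 : K), ϖ ^ (-a)]))
    (hT : (latticeGraph σ ϖ ((StdForm.antidiagonal 3).over K)).IsTree)
    (hH4 : ∀ (j : ℤ) (y : {M : Submodule 𝒪[K] (Fin 3 → K) // IsVertex σ ϖ ((StdForm.antidiagonal 3).over K) M}),
      (latticeGraph σ ϖ ((StdForm.antidiagonal 3).over K)).Adj (A j) y → y = A (j - 1) ∨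
      ∃ n : unitaryGroupOfForm σ ((StdForm.antidiagonal 3).over K), n ∈ unipotentU σ ((StdForm.antidiagonal 3).over K) ∧
        latticeGraphIso σ ϖ ((StdForm.antidiagonal 3).over K) n (A j) = A j ∧ latticeGraphIso σ ϖ ((StdForm.antidiagonal 3).over K) n (A (j + 1)) = y)
    {x y : {M : Submodule 𝒪[K] (Fin 3 → K) // IsVertex σ ϖ ((StdForm.antidiagonal 3).over K) M}}
    (hxy : (latticeGraph σ ϖ ((StdForm.antidiagonal 3).over K)).Adj x y) :
    ∃ u : unitaryGroupOfForm σ ((StdForm.antidiagonal 3).over K),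
      (latticeGraphIso σ ϖ ((StdForm.antidiagonal 3).over K) u (A 0) = x ∧ latticeGraphIso σ ϖ ((StdForm.antidiagonal 3).over K) u (A 1) = y) ∨
      (latticeGraphIso σ ϖ ((StdForm.antidiagonal 3).over K) u (A 0) = y ∧ latticeGraphIso σ ϖ ((StdForm.antidiagonal 3).over K) u (A 1) = x) := by
  obtain ⟨u, hu⟩ := exists_latticeGraphIso_sym2Map_apartmentEnum_zero_one_eq_of_adj_of_involution hσ hvσ hϖ A hA0 hA1 hT hH4 hxy
  rw [Sym2.map_mk, Sym2.eq_iff] at hu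
  exact ⟨u, hu⟩

/-- **`edgeSet` form, hypothesis-style** (the consumers' `act₁ g := (latticeGraphIso … g).mapEdgeSet`): every edge is the image of the standard edge `⟨s(A 0, A 1), _⟩` (certificate by
★ B1's `latticeGraph_adj_apartmentEnum_succ_of_involution`, proof-irrelevant).  Twin of ★ `exists_latticeGraphIso_mapEdgeSet_apartmentEnum_zero_one_eq`; conclusion VERBATIM.
[cite: BruhatTits1972, §10, (4.4.4)] [cite: Serre1980Trees, II.1.1] -/
theorem exists_latticeGraphIso_mapEdgeSet_apartmentEnum_zero_one_eq_of_involution (hσ : ∀ x, σ (σ x) = x) (hvσ : ∀ a, Valued.v (σ a) = Valued.v a) (hϖ : Valued.v ϖ = WithZero.exp (-1 : ℤ))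
    (A : ℤ → {M : Submodule 𝒪[K] (Fin 3 → K) // IsVertex σ ϖ ((StdForm.antidiagonal 3).over K) M})
    (hA0 : ∀ a : ℤ, (A (2 * a)).1 = latt (Matrix.diagonal ![ϖ ^ a, (1 : K), ϖ ^ (-a)]))
    (hA1 : ∀ a : ℤ, (A (2 * a + 1)).1 = latt (Matrix.diagonal ![ϖ ^ (a + 1), (1 : K), ϖ ^ (-a)]))
    (hT : (latticeGraph σ ϖ ((StdForm.antidiagonal 3).over K)).IsTree)
    (hH4 : ∀ (j : ℤ) (y : {M : Submodule 𝒪[K] (Fin 3 → K) // IsVertex σ ϖ ((StdForm.antidiagonal 3).over K) M}),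
      (latticeGraph σ ϖ ((StdForm.antidiagonal 3).over K)).Adj (A j) y → y = A (j - 1) ∨
      ∃ n : unitaryGroupOfForm σ ((StdForm.antidiagonal 3).over K), n ∈ unipotentU σ ((StdForm.antidiagonal 3).over K) ∧
        latticeGraphIso σ ϖ ((StdForm.antidiagonal 3).over K) n (A j) = A j ∧ latticeGraphIso σ ϖ ((StdForm.antidiagonal 3).over K) n (A (j + 1)) = y)
    (e : (latticeGraph σ ϖ ((StdForm.antidiagonal 3).over K)).edgeSet) :
    ∃ u : unitaryGroupOfForm σ ((StdForm.antidiagonal 3).over K),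
      (latticeGraphIso σ ϖ ((StdForm.antidiagonal 3).over K) u).mapEdgeSet
          ⟨s(A 0, A 1), (mem_edgeSet _).2 (by simpa using latticeGraph_adj_apartmentEnum_succ_of_involution hσ hvσ hϖ A hA0 hA1 0)⟩ = e := by
  obtain ⟨e, he⟩ := e
  induction e using Sym2.ind with
  | h x y =>
    obtain ⟨u, hu⟩ := exists_latticeGraphIso_sym2Map_apartmentEnum_zero_one_eq_of_adj_of_involution hσ hvσ hϖ A hA0 hA1 hT hH4 ((mem_edgeSet _).1 he)
    exact ⟨u, Subtype.ext hu⟩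

/-! ## §4 The orbit data packaged in the consumers' letters, hypothesis-style -/

/-- **VERTEX ORBIT DATA, hypothesis-style**: with representatives `xv := ![A 0, A 1]` there are an orbit index `idx₀ : Vtx → Fin 2` and transporters `tr₀ : Vtx → U` with
`idx₀ (xv i) = i`, `idx₀ (g · x) = idx₀ x`, `tr₀ x · xv (idx₀ x) = x` (the letters `hidx hidx_act htr` of ★ `BlockPermutationCompactInduction`).  Twin of ★ `exists_vertexOrbitData`
over `(hT) (hH4)` and the place-free exclusivity; conclusion VERBATIM. [cite: BruhatTits1972, §10] [cite: Serre1980Trees, II.1.1] -/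
theorem exists_vertexOrbitData_of_involution (hσ : ∀ x, σ (σ x) = x) (hvσ : ∀ a, Valued.v (σ a) = Valued.v a) (hϖ : Valued.v ϖ = WithZero.exp (-1 : ℤ))
    (A : ℤ → {M : Submodule 𝒪[K] (Fin 3 → K) // IsVertex σ ϖ ((StdForm.antidiagonal 3).over K) M})
    (hA0 : ∀ a : ℤ, (A (2 * a)).1 = latt (Matrix.diagonal ![ϖ ^ a, (1 : K), ϖ ^ (-a)]))
    (hA1 : ∀ a : ℤ, (A (2 * a + 1)).1 = latt (Matrix.diagonal ![ϖ ^ (a + 1), (1 : K), ϖ ^ (-a)]))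
    (hT : (latticeGraph σ ϖ ((StdForm.antidiagonal 3).over K)).IsTree)
    (hH4 : ∀ (j : ℤ) (y : {M : Submodule 𝒪[K] (Fin 3 → K) // IsVertex σ ϖ ((StdForm.antidiagonal 3).over K) M}),
      (latticeGraph σ ϖ ((StdForm.antidiagonal 3).over K)).Adj (A j) y → y = A (j - 1) ∨
      ∃ n : unitaryGroupOfForm σ ((StdForm.antidiagonal 3).over K), n ∈ unipotentU σ ((StdForm.antidiagonal 3).over K) ∧
        latticeGraphIso σ ϖ ((StdForm.antidiagonal 3).over K) n (A j) = A j ∧ latticeGraphIso σ ϖ ((StdForm.antidiagonal 3).over K) n (A (j + 1)) = y) :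
    ∃ (idx₀ : {M : Submodule 𝒪[K] (Fin 3 → K) // IsVertex σ ϖ ((StdForm.antidiagonal 3).over K) M} → Fin 2)
      (tr₀ : {M : Submodule 𝒪[K] (Fin 3 → K) // IsVertex σ ϖ ((StdForm.antidiagonal 3).over K) M} → unitaryGroupOfForm σ ((StdForm.antidiagonal 3).over K)),
      (∀ i : Fin 2, idx₀ (![A 0, A 1] i) = i) ∧
      (∀ (g : unitaryGroupOfForm σ ((StdForm.antidiagonal 3).over K)) (x : {M : Submodule 𝒪[K] (Fin 3 → K) // IsVertex σ ϖ ((StdForm.antidiagonal 3).over K) M}),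
          idx₀ (latticeGraphIso σ ϖ ((StdForm.antidiagonal 3).over K) g x) = idx₀ x) ∧
      ∀ x : {M : Submodule 𝒪[K] (Fin 3 → K) // IsVertex σ ϖ ((StdForm.antidiagonal 3).over K) M},
        latticeGraphIso σ ϖ ((StdForm.antidiagonal 3).over K) (tr₀ x) (![A 0, A 1] (idx₀ x)) = x := by
  classical
  -- the type-`0` predicate and its `U`-invariance
  let P : {M : Submodule 𝒪[K] (Fin 3 → K) // IsVertex σ ϖ ((StdForm.antidiagonal 3).over K) M} → Prop :=
    fun x => ∃ u : unitaryGroupOfForm σ ((StdForm.antidiagonal 3).over K), latticeGraphIso σ ϖ ((StdForm.antidiagonal 3).over K) u (A 0) = x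
  have hPinv : ∀ (g : unitaryGroupOfForm σ ((StdForm.antidiagonal 3).over K)) x, P (latticeGraphIso σ ϖ ((StdForm.antidiagonal 3).over K) g x) ↔ P x := by
    intro g x
    constructor
    · rintro ⟨u, hu⟩
      exact ⟨g⁻¹ * u, by rw [latticeGraphIso_mul_apply, hu, latticeGraphIso_inv_mul_apply]⟩
    · rintro ⟨u, hu⟩
      exact ⟨g * u, by rw [latticeGraphIso_mul_apply, hu]⟩
  have hP1 : ¬ P (A 1) := by
    rintro ⟨u, hu⟩
    exact not_exists_latticeGraphIso_apartmentEnum_one_eq_zero_of_v hσ hvσ hϖ A hA0 hA1 ⟨u⁻¹, by rw [← hu, latticeGraphIso_inv_mul_apply]⟩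
  refine ⟨fun x => if P x then 0 else 1,
    fun x => if h : P x then h.choose else (exists_latticeGraphIso_apartmentEnum_zero_eq_or_one_eq_of_involution hσ hvσ hϖ A hA0 hA1 hT hH4 x).choose,
    fun i => ?_, fun g x => ?_, fun x => ?_⟩
  · fin_cases i
    · have h0 : P (A 0) := ⟨1, latticeGraphIso_one_apply _⟩
      simp [h0]
    · simp [hP1]
  · simp only [hPinv]
  · by_cases h : P x
    · simp only [h, ↓reduceIte, dif_pos]
      exact h.choose_spec
    · simp only [h, ↓reduceIte, dif_neg, not_false_eq_true]
      exact (exists_latticeGraphIso_apartmentEnum_zero_eq_or_one_eq_of_involution hσ hvσ hϖ A hA0 hA1 hT hH4 x).choose_spec.resolve_left (fun h0 => h ⟨_, h0⟩)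

/-- **EDGE ORBIT DATA, hypothesis-style**: one orbit — transporters `tr₁ : edgeSet → U` with `tr₁ e · {A 0, A 1} = e`.  Twin of ★ `exists_edgeOrbitData`; conclusion VERBATIM
(certificate by ★ B1's `…_succ_of_involution`). [cite: BruhatTits1972, §10, (4.4.4)] [cite: Serre1980Trees, II.1.1] -/
theorem exists_edgeOrbitData_of_involution (hσ : ∀ x, σ (σ x) = x) (hvσ : ∀ a, Valued.v (σ a) = Valued.v a) (hϖ : Valued.v ϖ = WithZero.exp (-1 : ℤ))
    (A : ℤ → {M : Submodule 𝒪[K] (Fin 3 → K) // IsVertex σ ϖ ((StdForm.antidiagonal 3).over K) M})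
    (hA0 : ∀ a : ℤ, (A (2 * a)).1 = latt (Matrix.diagonal ![ϖ ^ a, (1 : K), ϖ ^ (-a)]))
    (hA1 : ∀ a : ℤ, (A (2 * a + 1)).1 = latt (Matrix.diagonal ![ϖ ^ (a + 1), (1 : K), ϖ ^ (-a)]))
    (hT : (latticeGraph σ ϖ ((StdForm.antidiagonal 3).over K)).IsTree)
    (hH4 : ∀ (j : ℤ) (y : {M : Submodule 𝒪[K] (Fin 3 → K) // IsVertex σ ϖ ((StdForm.antidiagonal 3).over K) M}),
      (latticeGraph σ ϖ ((StdForm.antidiagonal 3).over K)).Adj (A j) y → y = A (j - 1) ∨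
      ∃ n : unitaryGroupOfForm σ ((StdForm.antidiagonal 3).over K), n ∈ unipotentU σ ((StdForm.antidiagonal 3).over K) ∧
        latticeGraphIso σ ϖ ((StdForm.antidiagonal 3).over K) n (A j) = A j ∧ latticeGraphIso σ ϖ ((StdForm.antidiagonal 3).over K) n (A (j + 1)) = y) :
    ∃ tr₁ : (latticeGraph σ ϖ ((StdForm.antidiagonal 3).over K)).edgeSet → unitaryGroupOfForm σ ((StdForm.antidiagonal 3).over K),
      ∀ e, (latticeGraphIso σ ϖ ((StdForm.antidiagonal 3).over K) (tr₁ e)).mapEdgeSet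
          ⟨s(A 0, A 1), (mem_edgeSet _).2 (by simpa using latticeGraph_adj_apartmentEnum_succ_of_involution hσ hvσ hϖ A hA0 hA1 0)⟩ = e :=
  ⟨fun e => (exists_latticeGraphIso_mapEdgeSet_apartmentEnum_zero_one_eq_of_involution hσ hvσ hϖ A hA0 hA1 hT hH4 e).choose,
    fun e => (exists_latticeGraphIso_mapEdgeSet_apartmentEnum_zero_one_eq_of_involution hσ hvσ hϖ A hA0 hA1 hT hH4 e).choose_spec⟩

/-! ## §5 Layer II — at a tamely ramified place, unconditionally (`[ValuativeRel K]`; letters = ★ `isTree_latticeGraph_three_of_neg`'s) -/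

section Tame

variable [ValuativeRel K] [(Valued.v : Valuation K ℤᵐ⁰).Compatible]

/-- **AT A TAMELY RAMIFIED PLACE — EVERY VERTEX IS `u · A 0` OR `u · A 1`, UNCONDITIONALLY** (`hT` ↦ ★ `isTree_latticeGraph_three_of_neg`, `hH4` ↦ (S) `…_of_adj_of_neg`).
Conclusion VERBATIM = ★'s; the 55-B-RAM token pass is `hd ↦ hσ hvσ hϖ hσϖ hres h2 hnorm`. [cite: BruhatTits1972, §10, (4.4.4)] [cite: Tits1979, §2.4] [cite: Serre1980Trees, II.1.1] -/
theorem exists_latticeGraphIso_apartmentEnum_zero_eq_or_one_eq_of_neg (hσ : ∀ x, σ (σ x) = x) (hvσ : ∀ a, Valued.v (σ a) = Valued.v a) (hϖ : Valued.v ϖ = WithZero.exp (-1 : ℤ)) (hσϖ : σ ϖ = -ϖ)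
    (hres : ∀ x : K, Valued.v x ≤ 1 → Valued.v (σ x - x) < 1) (h2 : Valued.v (2 : K) = 1)
    (hnorm : ∀ u : K, σ u = u → Valued.v (u - 1) < 1 → ∃ z : K, z * σ z = u ∧ Valued.v (z - 1) ≤ Valued.v (u - 1))
    (A : ℤ → {M : Submodule 𝒪[K] (Fin 3 → K) // IsVertex σ ϖ ((StdForm.antidiagonal 3).over K) M})
    (hA0 : ∀ a : ℤ, (A (2 * a)).1 = latt (Matrix.diagonal ![ϖ ^ a, (1 : K), ϖ ^ (-a)]))
    (hA1 : ∀ a : ℤ, (A (2 * a + 1)).1 = latt (Matrix.diagonal ![ϖ ^ (a + 1), (1 : K), ϖ ^ (-a)]))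
    (x : {M : Submodule 𝒪[K] (Fin 3 → K) // IsVertex σ ϖ ((StdForm.antidiagonal 3).over K) M}) :
    ∃ u : unitaryGroupOfForm σ ((StdForm.antidiagonal 3).over K),
      latticeGraphIso σ ϖ ((StdForm.antidiagonal 3).over K) u (A 0) = x ∨ latticeGraphIso σ ϖ ((StdForm.antidiagonal 3).over K) u (A 1) = x :=
  exists_latticeGraphIso_apartmentEnum_zero_eq_or_one_eq_of_involution hσ hvσ hϖ A hA0 hA1 (isTree_latticeGraph_three_of_neg hσ hvσ hϖ hσϖ hres h2 hnorm)
    (fun j _ hy => eq_apartmentEnum_sub_one_or_exists_mem_unipotentU_of_adj_of_neg hσ hvσ hϖ hσϖ hres h2 A hA0 hA1 j hy) x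

/-- **AT A TAMELY RAMIFIED PLACE — `U` IS TRANSITIVE ON THE EDGES, UNCONDITIONALLY.**  Conclusion VERBATIM = ★ `exists_latticeGraphIso_sym2Map_apartmentEnum_zero_one_eq_of_adj`'s.
[cite: BruhatTits1972, §10, (4.4.4)] [cite: Tits1979, §2.4] [cite: Serre1980Trees, II.1.1] -/
theorem exists_latticeGraphIso_sym2Map_apartmentEnum_zero_one_eq_of_adj_of_neg (hσ : ∀ x, σ (σ x) = x) (hvσ : ∀ a, Valued.v (σ a) = Valued.v a) (hϖ : Valued.v ϖ = WithZero.exp (-1 : ℤ)) (hσϖ : σ ϖ = -ϖ)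
    (hres : ∀ x : K, Valued.v x ≤ 1 → Valued.v (σ x - x) < 1) (h2 : Valued.v (2 : K) = 1)
    (hnorm : ∀ u : K, σ u = u → Valued.v (u - 1) < 1 → ∃ z : K, z * σ z = u ∧ Valued.v (z - 1) ≤ Valued.v (u - 1))
    (A : ℤ → {M : Submodule 𝒪[K] (Fin 3 → K) // IsVertex σ ϖ ((StdForm.antidiagonal 3).over K) M})
    (hA0 : ∀ a : ℤ, (A (2 * a)).1 = latt (Matrix.diagonal ![ϖ ^ a, (1 : K), ϖ ^ (-a)]))
    (hA1 : ∀ a : ℤ, (A (2 * a + 1)).1 = latt (Matrix.diagonal ![ϖ ^ (a + 1), (1 : K), ϖ ^ (-a)]))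
    {x y : {M : Submodule 𝒪[K] (Fin 3 → K) // IsVertex σ ϖ ((StdForm.antidiagonal 3).over K) M}}
    (hxy : (latticeGraph σ ϖ ((StdForm.antidiagonal 3).over K)).Adj x y) :
    ∃ u : unitaryGroupOfForm σ ((StdForm.antidiagonal 3).over K), Sym2.map (latticeGraphIso σ ϖ ((StdForm.antidiagonal 3).over K) u) s(A 0, A 1) = s(x, y) :=
  exists_latticeGraphIso_sym2Map_apartmentEnum_zero_one_eq_of_adj_of_involution hσ hvσ hϖ A hA0 hA1 (isTree_latticeGraph_three_of_neg hσ hvσ hϖ hσϖ hres h2 hnorm)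
    (fun j _ hy => eq_apartmentEnum_sub_one_or_exists_mem_unipotentU_of_adj_of_neg hσ hvσ hϖ hσϖ hres h2 A hA0 hA1 j hy) hxy

/-- **AT A TAMELY RAMIFIED PLACE — oriented-or form, unconditionally.**  Conclusion VERBATIM = ★ `exists_latticeGraphIso_apartmentEnum_zero_one_eq_of_adj`'s. [cite: BruhatTits1972, §10, (4.4.4)] [cite: Tits1979, §2.4] [cite: Serre1980Trees, II.1.1] -/
theorem exists_latticeGraphIso_apartmentEnum_zero_one_eq_of_adj_of_neg (hσ : ∀ x, σ (σ x) = x) (hvσ : ∀ a, Valued.v (σ a) = Valued.v a) (hϖ : Valued.v ϖ = WithZero.exp (-1 : ℤ)) (hσϖ : σ ϖ = -ϖ)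
    (hres : ∀ x : K, Valued.v x ≤ 1 → Valued.v (σ x - x) < 1) (h2 : Valued.v (2 : K) = 1)
    (hnorm : ∀ u : K, σ u = u → Valued.v (u - 1) < 1 → ∃ z : K, z * σ z = u ∧ Valued.v (z - 1) ≤ Valued.v (u - 1))
    (A : ℤ → {M : Submodule 𝒪[K] (Fin 3 → K) // IsVertex σ ϖ ((StdForm.antidiagonal 3).over K) M})
    (hA0 : ∀ a : ℤ, (A (2 * a)).1 = latt (Matrix.diagonal ![ϖ ^ a, (1 : K), ϖ ^ (-a)]))
    (hA1 : ∀ a : ℤ, (A (2 * a + 1)).1 = latt (Matrix.diagonal ![ϖ ^ (a + 1), (1 : K), ϖ ^ (-a)]))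
    {x y : {M : Submodule 𝒪[K] (Fin 3 → K) // IsVertex σ ϖ ((StdForm.antidiagonal 3).over K) M}}
    (hxy : (latticeGraph σ ϖ ((StdForm.antidiagonal 3).over K)).Adj x y) :
    ∃ u : unitaryGroupOfForm σ ((StdForm.antidiagonal 3).over K),
      (latticeGraphIso σ ϖ ((StdForm.antidiagonal 3).over K) u (A 0) = x ∧ latticeGraphIso σ ϖ ((StdForm.antidiagonal 3).over K) u (A 1) = y) ∨
      (latticeGraphIso σ ϖ ((StdForm.antidiagonal 3).over K) u (A 0) = y ∧ latticeGraphIso σ ϖ ((StdForm.antidiagonal 3).over K) u (A 1) = x) :=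
  exists_latticeGraphIso_apartmentEnum_zero_one_eq_of_adj_of_involution hσ hvσ hϖ A hA0 hA1 (isTree_latticeGraph_three_of_neg hσ hvσ hϖ hσϖ hres h2 hnorm)
    (fun j _ hy => eq_apartmentEnum_sub_one_or_exists_mem_unipotentU_of_adj_of_neg hσ hvσ hϖ hσϖ hres h2 A hA0 hA1 j hy) hxy

/-- **AT A TAMELY RAMIFIED PLACE — `edgeSet` form, unconditionally.**  Conclusion VERBATIM = ★ `exists_latticeGraphIso_mapEdgeSet_apartmentEnum_zero_one_eq`'s. [cite: BruhatTits1972, §10, (4.4.4)] [cite: Tits1979, §2.4] [cite: Serre1980Trees, II.1.1] -/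
theorem exists_latticeGraphIso_mapEdgeSet_apartmentEnum_zero_one_eq_of_neg (hσ : ∀ x, σ (σ x) = x) (hvσ : ∀ a, Valued.v (σ a) = Valued.v a) (hϖ : Valued.v ϖ = WithZero.exp (-1 : ℤ)) (hσϖ : σ ϖ = -ϖ)
    (hres : ∀ x : K, Valued.v x ≤ 1 → Valued.v (σ x - x) < 1) (h2 : Valued.v (2 : K) = 1)
    (hnorm : ∀ u : K, σ u = u → Valued.v (u - 1) < 1 → ∃ z : K, z * σ z = u ∧ Valued.v (z - 1) ≤ Valued.v (u - 1))
    (A : ℤ → {M : Submodule 𝒪[K] (Fin 3 → K) // IsVertex σ ϖ ((StdForm.antidiagonal 3).over K) M})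
    (hA0 : ∀ a : ℤ, (A (2 * a)).1 = latt (Matrix.diagonal ![ϖ ^ a, (1 : K), ϖ ^ (-a)]))
    (hA1 : ∀ a : ℤ, (A (2 * a + 1)).1 = latt (Matrix.diagonal ![ϖ ^ (a + 1), (1 : K), ϖ ^ (-a)]))
    (e : (latticeGraph σ ϖ ((StdForm.antidiagonal 3).over K)).edgeSet) :
    ∃ u : unitaryGroupOfForm σ ((StdForm.antidiagonal 3).over K),
      (latticeGraphIso σ ϖ ((StdForm.antidiagonal 3).over K) u).mapEdgeSet
          ⟨s(A 0, A 1), (mem_edgeSet _).2 (by simpa using latticeGraph_adj_apartmentEnum_succ_of_involution hσ hvσ hϖ A hA0 hA1 0)⟩ = e :=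
  exists_latticeGraphIso_mapEdgeSet_apartmentEnum_zero_one_eq_of_involution hσ hvσ hϖ A hA0 hA1 (isTree_latticeGraph_three_of_neg hσ hvσ hϖ hσϖ hres h2 hnorm)
    (fun j _ hy => eq_apartmentEnum_sub_one_or_exists_mem_unipotentU_of_adj_of_neg hσ hvσ hϖ hσϖ hres h2 A hA0 hA1 j hy) e

/-- **AT A TAMELY RAMIFIED PLACE — VERTEX ORBIT DATA, UNCONDITIONALLY** (two vertex orbits; the letters `xv idx₀ tr₀ hidx₀ hidx₀a htr₀` of the datum file B).  Conclusion VERBATIM =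
★ `exists_vertexOrbitData`'s. [cite: BruhatTits1972, §10, (4.4.4)] [cite: Tits1979, §2.4] [cite: Serre1980Trees, II.1.1] -/
theorem exists_vertexOrbitData_of_neg (hσ : ∀ x, σ (σ x) = x) (hvσ : ∀ a, Valued.v (σ a) = Valued.v a) (hϖ : Valued.v ϖ = WithZero.exp (-1 : ℤ)) (hσϖ : σ ϖ = -ϖ)
    (hres : ∀ x : K, Valued.v x ≤ 1 → Valued.v (σ x - x) < 1) (h2 : Valued.v (2 : K) = 1)
    (hnorm : ∀ u : K, σ u = u → Valued.v (u - 1) < 1 → ∃ z : K, z * σ z = u ∧ Valued.v (z - 1) ≤ Valued.v (u - 1))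
    (A : ℤ → {M : Submodule 𝒪[K] (Fin 3 → K) // IsVertex σ ϖ ((StdForm.antidiagonal 3).over K) M})
    (hA0 : ∀ a : ℤ, (A (2 * a)).1 = latt (Matrix.diagonal ![ϖ ^ a, (1 : K), ϖ ^ (-a)]))
    (hA1 : ∀ a : ℤ, (A (2 * a + 1)).1 = latt (Matrix.diagonal ![ϖ ^ (a + 1), (1 : K), ϖ ^ (-a)])) :
    ∃ (idx₀ : {M : Submodule 𝒪[K] (Fin 3 → K) // IsVertex σ ϖ ((StdForm.antidiagonal 3).over K) M} → Fin 2)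
      (tr₀ : {M : Submodule 𝒪[K] (Fin 3 → K) // IsVertex σ ϖ ((StdForm.antidiagonal 3).over K) M} → unitaryGroupOfForm σ ((StdForm.antidiagonal 3).over K)),
      (∀ i : Fin 2, idx₀ (![A 0, A 1] i) = i) ∧
      (∀ (g : unitaryGroupOfForm σ ((StdForm.antidiagonal 3).over K)) (x : {M : Submodule 𝒪[K] (Fin 3 → K) // IsVertex σ ϖ ((StdForm.antidiagonal 3).over K) M}),
          idx₀ (latticeGraphIso σ ϖ ((StdForm.antidiagonal 3).over K) g x) = idx₀ x) ∧
      ∀ x : {M : Submodule 𝒪[K] (Fin 3 → K) // IsVertex σ ϖ ((StdForm.antidiagonal 3).over K) M},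
        latticeGraphIso σ ϖ ((StdForm.antidiagonal 3).over K) (tr₀ x) (![A 0, A 1] (idx₀ x)) = x :=
  exists_vertexOrbitData_of_involution hσ hvσ hϖ A hA0 hA1 (isTree_latticeGraph_three_of_neg hσ hvσ hϖ hσϖ hres h2 hnorm)
    (fun j _ hy => eq_apartmentEnum_sub_one_or_exists_mem_unipotentU_of_adj_of_neg hσ hvσ hϖ hσϖ hres h2 A hA0 hA1 j hy)

/-- **AT A TAMELY RAMIFIED PLACE — EDGE ORBIT DATA, UNCONDITIONALLY** (one edge orbit).  Conclusion VERBATIM = ★ `exists_edgeOrbitData`'s. [cite: BruhatTits1972, §10, (4.4.4)] [cite: Tits1979, §2.4] [cite: Serre1980Trees, II.1.1] -/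
theorem exists_edgeOrbitData_of_neg (hσ : ∀ x, σ (σ x) = x) (hvσ : ∀ a, Valued.v (σ a) = Valued.v a) (hϖ : Valued.v ϖ = WithZero.exp (-1 : ℤ)) (hσϖ : σ ϖ = -ϖ)
    (hres : ∀ x : K, Valued.v x ≤ 1 → Valued.v (σ x - x) < 1) (h2 : Valued.v (2 : K) = 1)
    (hnorm : ∀ u : K, σ u = u → Valued.v (u - 1) < 1 → ∃ z : K, z * σ z = u ∧ Valued.v (z - 1) ≤ Valued.v (u - 1))
    (A : ℤ → {M : Submodule 𝒪[K] (Fin 3 → K) // IsVertex σ ϖ ((StdForm.antidiagonal 3).over K) M})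
    (hA0 : ∀ a : ℤ, (A (2 * a)).1 = latt (Matrix.diagonal ![ϖ ^ a, (1 : K), ϖ ^ (-a)]))
    (hA1 : ∀ a : ℤ, (A (2 * a + 1)).1 = latt (Matrix.diagonal ![ϖ ^ (a + 1), (1 : K), ϖ ^ (-a)])) :
    ∃ tr₁ : (latticeGraph σ ϖ ((StdForm.antidiagonal 3).over K)).edgeSet → unitaryGroupOfForm σ ((StdForm.antidiagonal 3).over K),
      ∀ e, (latticeGraphIso σ ϖ ((StdForm.antidiagonal 3).over K) (tr₁ e)).mapEdgeSet
          ⟨s(A 0, A 1), (mem_edgeSet _).2 (by simpa using latticeGraph_adj_apartmentEnum_succ_of_involution hσ hvσ hϖ A hA0 hA1 0)⟩ = e :=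
  exists_edgeOrbitData_of_involution hσ hvσ hϖ A hA0 hA1 (isTree_latticeGraph_three_of_neg hσ hvσ hϖ hσϖ hres h2 hnorm)
    (fun j _ hy => eq_apartmentEnum_sub_one_or_exists_mem_unipotentU_of_adj_of_neg hσ hvσ hϖ hσϖ hres h2 A hA0 hA1 j hy)

end Tame

end Literature.NumberTheory.Automorphic.UnitaryLatticeTree
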